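import Literature.Barriers.CriticalPhenomena.WeaklySAWCouplingFlowStability
import Literature.Barriers.CriticalPhenomena.WeaklySAWCouplingFlowComparison
import Literature.Barriers.CriticalPhenomena.WeaklySAWPerturbativeBetaMassInsensitivity
import HarnessLib

/-!
# BBS 2015, §7.3.1, Lemma 7.3.1 (i), (iii): the sequence `g̃_j(m²,g₀) = ḡ_{min(j,j_m)}(0,g₀)` —
# "the massless sequence with its evolution shut down at the mass scale" — satisfies
# `g̃_j = ḡ_j(m²,g₀) + O(ḡ_j²(m²,g₀))`, and is monotone in `m²` and in `g₀`

Source: Bauerschmidt–Brydges–Slade, CMP 337 (2015) [BBS2015], §6.3 (definition (ggendef)): "we set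
`g̃_j(m²,g₀) = ḡ_j(0,g₀)𝟙_{j≤j_m} + ḡ_{j_m}(0,g₀)𝟙_{j>j_m}`, where the mass scale `j_m` is the smallest
integer `j` such that `L^{2j}m² ≥ 1`. Thus `g̃_j(m²,g₀)` is the massless sequence `ḡ_j(0,g₀)` with its
evolution shut down at the mass scale. We show in Lemma 7.3.1 that
`g̃_j(m²,g₀) = ḡ_j(m²,g₀) + O(ḡ_j²(m²,g₀))`"; and §7.3.1, Lemma 7.3.1: "(i) There exists `δ > 0` such
that uniformly in `(m²,g₀) ∈ (0,δ)²` and in `j ∈ ℕ₀`, `g̃_j(m²,g₀) = ḡ_j(m²,g₀) + O(ḡ_j²(m²,g₀))`. …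
(iii) For `j ∈ ℕ₀`, `g̃_j(m²,g₀)` is monotone increasing in each of `m²` and `g₀`." with its proof:
"(i) … For `j ≤ j_m`, by integrating the derivative we obtain `|ḡ_j(0) - ḡ_j(m²)| ≤ O(ḡ_j²(m_*²))` …
`ḡ_j(m²) = ḡ_j(0) + O(ḡ_j(0)²)` for `j ≤ j_m` as claimed. For `j ≥ j_m`, we iterate (gbar), and use
`ḡ_l ≤ ḡ_{j_m}` for `l ≥ j_m` (which is immediate from `β_k ≥ 0`) and `Σ_{l=j_m}^∞|β_l| = O(1)` (by
[BBS-rg-pt]), to obtain `ḡ_j = ḡ_{j_m}∏_{l=j_m}^{j-1}(1 - β_lḡ_l) = … = ḡ_{j_m} + O(ḡ_{j_m}²)` … (iii)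
The sequence `ḡ` is monotone increasing in `g₀` … Also, the sequence `ḡ` is decreasing in `j` since
`β_k ≥ 0` for all `k`, while `j_m` is decreasing in `m²`, so `g̃` is increasing in `m²`."

For the EXPLICIT coefficients `β_j(m²) = betaPT 4 L m² j` of this tree (`d = 4`), the step
"`|ḡ_j(0) - ḡ_j(m²)| = O(ḡ_j²)` for `j ≤ j_m`" is obtained here in finite-difference form: the
`ℓ¹`-stability of the `ḡ`-recursion with relative error (`WeaklySAWCouplingFlowStability.lean`) fed
with the mass-insensitivity `|β_l(m²) - β_l(0)| ≤ K(L^{-l} + m²L^{2l})`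
(`WeaklySAWPerturbativeBetaMassInsensitivity.lean`, [BBS-rg-pt, Lemma 6.3.1 (proof)]), whose sum
over `l < j ≤ j_m` is `O(1)`; the step `j > j_m` uses `Σ_{l≥j_m}β_l(m²) = O(1)` from the decay beyond
the mass scale (`WeaklySAWPerturbativeBetaMassDecay.lean`).

## What this file provides

* `massScale L m²` — `j_m`, the smallest `j` with `L^{2j}m² ≥ 1` (for `m² > 0`; `0` is a junk value
  at `m² ≤ 0`, never used), `massScale_spec`, `lt_one_of_lt_massScale`, `massScale_anti`;
* `gtilde L m² g₀ j` — the printed `g̃_j(m²,g₀)` (`= ḡ_j(0,g₀)` at `m² = 0`, where `j_m = ∞`);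
* `gbar_sub_gbar_add_eq_sum` (`ḡ_i - ḡ_{i+n} = Σ_{l<n}β_{i+l}ḡ_{i+l}²`), `gbar_le_gbar_init`
  (`ḡ_j` is non-decreasing in `g₀`);
* **`BBS2015_lem731_i`** — Lemma 7.3.1(i): `|g̃_j(m²,g₀) - ḡ_j(m²,g₀)| ≤ Cḡ_j(m²,g₀)²` uniformly in
  `(m²,g₀) ∈ [0,δ) × (0,δ)` and `j`;
* **`BBS2015_lem731_iii`** — Lemma 7.3.1(iii): `g̃_j` is non-decreasing in `g₀` and in `m²`;
* `massScale_sub_le_one` (`|j_m - j_{m̂}| ≤ 1` when `|m² - m̂²| ≤ θm̂²`, `θ ≤ 1 - L⁻²`),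
  `abs_gbar_sub_gbar_of_dist_le_one` (indices differing by `≤ 1` cost `O(ḡ²)`), and
  **`BBS2015_lem731_ii`** — Lemma 7.3.1(ii): `|g̃_j(m²,g₀) - g̃_j(m̂²,ĝ₀)| ≤ (θ + Cg₀)g̃_j(m̂²,ĝ₀)`
  whenever `|m² - m̂²| ≤ θm̂²`, `|g₀ - ĝ₀| ≤ θĝ₀` (`θ ≤ ½`).
-/

noncomputable section

open Set Filter Topology Finset
open Literature.Probability.LatticeModels
open scoped BigOperators

namespace Literature.Barriers.CriticalPhenomena

namespace CTWSAW

open LongRangePhi4 LongRangePhi4.FRD PT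

/-! ### The mass scale `j_m` and `g̃` -/

/-- **The mass scale `j_m`**: the smallest integer `j` with `L^{2j}m² ≥ 1` (for `m² > 0`, `L > 1`,
where such `j` exist; the junk value `0` otherwise). [cite: BauerschmidtBrydgesSlade2015LogCorr, §6.3, display (ggendef) ("the mass scale j_m is the smallest integer j such that L^{2j}m² ≥ 1")] -/
def massScale (L s : ℝ) : ℕ := by
  classical
  exact if h : ∃ j : ℕ, 1 ≤ s * L ^ (2 * j) then Nat.find h else 0

/-- For `m² > 0` and `L > 1` there is a scale with `L^{2j}m² ≥ 1`. [cite: BauerschmidtBrydgesSlade2015LogCorr, §6.3, (ggendef)] -/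
theorem exists_one_le_mul_pow {L : ℝ} (hL : 1 < L) {s : ℝ} (hs : 0 < s) : ∃ j : ℕ, 1 ≤ s * L ^ (2 * j) := by
  have hL2 : 1 < L ^ 2 := by nlinarith
  obtain ⟨k, hk⟩ := pow_unbounded_of_one_lt (1 / s) hL2
  refine ⟨k, ?_⟩
  rw [pow_mul]
  rw [div_lt_iff₀ hs] at hk
  linarith

/-- `L^{2j_m}m² ≥ 1` and `j_m` is the least such scale (`m² > 0`, `L > 1`). [cite: BauerschmidtBrydgesSlade2015LogCorr, §6.3, (ggendef)] -/
theorem massScale_spec {L : ℝ} (hL : 1 < L) {s : ℝ} (hs : 0 < s) :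
    1 ≤ s * L ^ (2 * massScale L s) ∧ ∀ j, j < massScale L s → s * L ^ (2 * j) < 1 := by
  classical
  have hex := exists_one_le_mul_pow hL hs
  unfold massScale
  rw [dif_pos hex]
  exact ⟨Nat.find_spec hex, fun j hj => not_le.1 (Nat.find_min hex hj)⟩

/-- Below the mass scale, `L^{2j}m² < 1`. [cite: BauerschmidtBrydgesSlade2015LogCorr, §6.3, (ggendef)] -/
theorem lt_one_of_lt_massScale {L : ℝ} (hL : 1 < L) {s : ℝ} (hs : 0 < s) {j : ℕ}
    (hj : j < massScale L s) : s * L ^ (2 * j) < 1 :=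
  (massScale_spec hL hs).2 j hj

/-- `j_m ≤ j` as soon as `L^{2j}m² ≥ 1`. [cite: BauerschmidtBrydgesSlade2015LogCorr, §6.3, (ggendef)] -/
theorem massScale_le_of_one_le {L s : ℝ} {j : ℕ} (hj : 1 ≤ s * L ^ (2 * j)) : massScale L s ≤ j := by
  classical
  have hex : ∃ j : ℕ, 1 ≤ s * L ^ (2 * j) := ⟨j, hj⟩
  unfold massScale
  rw [dif_pos hex]
  exact Nat.find_min' hex hj

/-- **`j_m` is non-increasing in `m²`.** [cite: BauerschmidtBrydgesSlade2015LogCorr, §7.3.1, Lemma 7.3.1(iii) (proof: "j_m is decreasing in m²")] -/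
theorem massScale_anti {L : ℝ} (hL : 1 < L) {s s' : ℝ} (hs : 0 < s) (hss' : s ≤ s') :
    massScale L s' ≤ massScale L s := by
  refine massScale_le_of_one_le ?_
  have h1 := (massScale_spec hL hs).1
  have : s * L ^ (2 * massScale L s) ≤ s' * L ^ (2 * massScale L s) :=
    mul_le_mul_of_nonneg_right hss' (by positivity)
  linarith

/-- **`g̃_j(m²,g₀) = ḡ_j(0,g₀)𝟙_{j≤j_m} + ḡ_{j_m}(0,g₀)𝟙_{j>j_m} = ḡ_{min(j,j_m)}(0,g₀)`** for the
explicit coefficients (`d = 4`); at `m² = 0` (`j_m = ∞`), `g̃_j = ḡ_j(0,g₀)`.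
[cite: BauerschmidtBrydgesSlade2015LogCorr, §6.3, display (ggendef)] -/
def gtilde (L s g₀ : ℝ) (j : ℕ) : ℝ :=
  gbar (betaPT 4 L 0) g₀ (if 0 < s then min j (massScale L s) else j)

/-- At `m² = 0`: `g̃_j = ḡ_j(0,g₀)`. [cite: BauerschmidtBrydgesSlade2015LogCorr, §6.3, (ggendef)] -/
theorem gtilde_zero (L g₀ : ℝ) (j : ℕ) : gtilde L 0 g₀ j = gbar (betaPT 4 L 0) g₀ j := by
  simp [gtilde]

/-- For `m² > 0`: `g̃_j = ḡ_{min(j,j_m)}(0,g₀)`. [cite: BauerschmidtBrydgesSlade2015LogCorr, §6.3, (ggendef)] -/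
theorem gtilde_of_pos {L s : ℝ} (hs : 0 < s) (g₀ : ℝ) (j : ℕ) :
    gtilde L s g₀ j = gbar (betaPT 4 L 0) g₀ (min j (massScale L s)) := by
  simp [gtilde, hs]

/-! ### Two more elementary facts on `ḡ` -/

/-- `ḡ_i - ḡ_{i+n} = Σ_{l<n}β_{i+l}ḡ_{i+l}²` ("we iterate (gbar)"). [cite: BauerschmidtBrydgesSlade2015LogCorr, §7.3.1, Lemma 7.3.1(i) (proof, the case j ≥ j_m)] -/
theorem gbar_sub_gbar_add_eq_sum (β : ℕ → ℝ) (g₀ : ℝ) (i n : ℕ) :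
    gbar β g₀ i - gbar β g₀ (i + n) = ∑ l ∈ Finset.range n, β (i + l) * gbar β g₀ (i + l) ^ 2 := by
  induction n with
  | zero => simp
  | succ n ih =>
    rw [Finset.sum_range_succ, ← ih, ← add_assoc, gbar_succ]
    ring

/-- **`ḡ_j` is non-decreasing in the initial condition** (`β ≥ 0`, `Bg' ≤ 1/4`, `0 < g ≤ g'`): the map
`x ↦ x - βx²` is non-decreasing on `[0, 1/(2β)]`. [cite: BauerschmidtBrydgesSlade2015LogCorr, §7.3.1, Lemma 7.3.1(iii) (proof: "The sequence ḡ is monotone increasing in g₀ (by [BBS-rg-flow, Lemma 2.1])")] -/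
theorem gbar_le_gbar_init {β : ℕ → ℝ} {B g g' : ℝ} (hg : GbarHyp β B g) (hg' : GbarHyp β B g')
    (hle : g ≤ g') (j : ℕ) : gbar β g j ≤ gbar β g' j := by
  induction j with
  | zero => simpa using hle
  | succ j ih =>
    rw [gbar_succ, gbar_succ]
    have h1 := hg.beta_mul_gbar_le j
    have h2 := hg'.beta_mul_gbar_le j
    have hβ := hg.beta_nonneg j
    have ha := (hg.gbar_pos j).le
    -- `x - βx² ≤ y - βy²` iff `(y-x)(1 - β(x+y)) ≥ 0`
    nlinarith [mul_nonneg (sub_nonneg.2 ih) (by nlinarith : (0 : ℝ) ≤ 1 - β j * (gbar β g j + gbar β g' j))]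

/-! ### Lemma 7.3.1(i) -/

/-- The hypotheses `GbarHyp` for the explicit `β_j(m²)` (`L ≥ 2`, `m² ≥ 0`): `0 ≤ β_j(m²) ≤ KL⁴` and
`g₀` small. [cite: BauerschmidtBrydgesSlade2015LogCorr, §6.1 (β_j ≥ 0; Assumption (A1): β bounded)] -/
theorem gbarHyp_betaPT {K : ℝ} (hK : ∀ L : ℝ, 2 ≤ L → ∀ s : ℝ, 0 ≤ s → ∀ j : ℕ, |betaPT 4 L s j| ≤ K * L ^ 4)
    {L : ℝ} (hL : 2 ≤ L) {s : ℝ} (hs : 0 ≤ s) {g₀ : ℝ} (hg₀ : 0 < g₀) (hsmall : K * L ^ 4 * g₀ ≤ 1 / 4) :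
    GbarHyp (betaPT 4 L s) (K * L ^ 4) g₀ where
  beta_nonneg j := betaPT_nonneg_of_nonneg (by norm_num) (by linarith) hs j
  beta_le j := (le_abs_self _).trans (hK L hL s hs j)
  pos := hg₀
  small := hsmall

/-- The sum of the mass-insensitivity bounds below the mass scale is `O(1)`:
`Σ_{l<j}(L^{-l} + m²L^{2l}) ≤ 2 + 2L²` for `j ≤ j_m` (`L ≥ 2`, `0 < m² ≤ 1`).
[cite: BauerschmidtBrydgesSlade2015LogCorr, §7.3.1, Lemma 7.3.1(i) (proof: the case j ≤ j_m)] -/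
theorem sum_massInsensitivity_le {L : ℝ} (hL : 2 ≤ L) {s : ℝ} (hs : 0 < s) {j : ℕ}
    (hj : j ≤ massScale L s) :
    ∑ l ∈ Finset.range j, (1 / L ^ l + s * L ^ (2 * l)) ≤ 2 + 2 * L ^ 2 := by
  have hL1 : (1 : ℝ) < L := by linarith
  have hL0 : (0 : ℝ) < L := by linarith
  rw [Finset.sum_add_distrib]
  have h1 : ∑ l ∈ Finset.range j, 1 / L ^ l ≤ 2 := by
    have hq0 : (0 : ℝ) ≤ 1 / L := by positivity
    have hq1 : 1 / L < 1 := by rw [div_lt_one hL0]; linarith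
    calc ∑ l ∈ Finset.range j, 1 / L ^ l = ∑ l ∈ Finset.range j, (1 / L) ^ l := by
          refine Finset.sum_congr rfl fun l _ => by rw [one_div_pow]
      _ ≤ ∑' l, (1 / L) ^ l := (summable_geometric_of_lt_one hq0 hq1).sum_le_tsum _ fun l _ => by positivity
      _ = (1 - 1 / L)⁻¹ := tsum_geometric_of_lt_one hq0 hq1
      _ ≤ 2 := by
          rw [inv_le_comm₀ (by linarith) (by norm_num)]
          have : 1 / L ≤ 1 / 2 := one_div_le_one_div_of_le (by norm_num) hL
          linarith
  have h2 : ∑ l ∈ Finset.range j, s * L ^ (2 * l) ≤ 2 * L ^ 2 := by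
    rcases Nat.eq_zero_or_pos j with hj0 | hj0
    · subst hj0; simp; positivity
    · -- `sL^{2l} ≤ sL^{2(j-1)}·L^{-2(j-1-l)}` and `sL^{2(j-1)} < 1` since `j - 1 < j_m`
      have hjm : s * L ^ (2 * (j - 1)) < 1 := lt_one_of_lt_massScale hL1 hs (by omega)
      calc ∑ l ∈ Finset.range j, s * L ^ (2 * l) = s * ∑ l ∈ Finset.range j, L ^ (2 * l) := by
            rw [Finset.mul_sum]
        _ ≤ s * (2 * L ^ (2 * j)) := mul_le_mul_of_nonneg_left (geom_sum_sq_le hL j) hs.le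
        _ = 2 * L ^ 2 * (s * L ^ (2 * (j - 1))) := by
            have : 2 * j = 2 * (j - 1) + 2 := by omega
            rw [this, pow_add]; ring
        _ ≤ 2 * L ^ 2 * 1 := mul_le_mul_of_nonneg_left hjm.le (by positivity)
        _ = 2 * L ^ 2 := mul_one _
  linarith

/-- **BBS 2015, Lemma 7.3.1(i), for the explicit decomposition** (`d = 4`, `L ≥ 2`): there are
`δ > 0` and `C` such that `|g̃_j(m²,g₀) - ḡ_j(m²,g₀)| ≤ Cḡ_j(m²,g₀)²` uniformly in
`(m²,g₀) ∈ [0,δ) × (0,δ)` and in `j ∈ ℕ₀` ("`g̃_j(m²,g₀) = ḡ_j(m²,g₀) + O(ḡ_j²(m²,g₀))`").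
[cite: BauerschmidtBrydgesSlade2015LogCorr, §7.3.1, Lemma 7.3.1(i)] -/
theorem BBS2015_lem731_i {L : ℝ} (hL : 2 ≤ L) : ∃ δ C : ℝ, 0 < δ ∧ 0 < C ∧
    ∀ s : ℝ, 0 ≤ s → s < δ → ∀ g₀ : ℝ, 0 < g₀ → g₀ < δ → ∀ j : ℕ,
      |gtilde L s g₀ j - gbar (betaPT 4 L s) g₀ j| ≤ C * gbar (betaPT 4 L s) g₀ j ^ 2 := by
  have hL1 : (1 : ℝ) < L := by linarith
  have hL0 : (0 : ℝ) < L := by linarith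
  obtain ⟨KB, hKB, hB⟩ := BBS2015_A1_bounded
  obtain ⟨K, hK, hM⟩ := abs_betaPT_mass_sub_le hL
  obtain ⟨Cd, hCd, hdec⟩ := abs_betaPT_le_cutoff (Ω := 2) one_lt_two hL
  -- the `ℓ¹`-size of the perturbation below the mass scale, and the tail beyond it
  set E : ℝ := K * (2 + 2 * L ^ 2) with hE
  have hE0 : 0 < E := by positivity
  set D : ℝ := 2 * Cd with hD
  set B : ℝ := KB * L ^ 4 with hBdef
  set δ : ℝ := min 1 (min (1 / (4 * B + 1)) (min (1 / (16 * E + 1)) (1 / (4 * D + 1)))) with hδ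
  have hδ0 : 0 < δ := by positivity
  have hδ1 : δ ≤ 1 := min_le_left _ _
  refine ⟨δ, 4 * (6 * E + D), hδ0, by positivity, fun s hs hsδ g₀ hg₀ hg₀δ j => ?_⟩
  have hs1 : s ≤ 1 := (hsδ.le.trans hδ1)
  -- smallness of `g₀`
  have hgB : B * g₀ ≤ 1 / 4 := by
    have h1 : g₀ ≤ 1 / (4 * B + 1) := hg₀δ.le.trans ((min_le_right _ _).trans (min_le_left _ _))
    have hB0 : 0 ≤ B := by positivity
    calc B * g₀ ≤ B * (1 / (4 * B + 1)) := mul_le_mul_of_nonneg_left h1 hB0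
      _ ≤ 1 / 4 := by rw [mul_one_div, div_le_iff₀ (by positivity)]; nlinarith
  have hgE : 16 * E * g₀ ≤ 1 := by
    have h1 : g₀ ≤ 1 / (16 * E + 1) :=
      hg₀δ.le.trans ((min_le_right _ _).trans ((min_le_right _ _).trans (min_le_left _ _)))
    calc 16 * E * g₀ ≤ 16 * E * (1 / (16 * E + 1)) := mul_le_mul_of_nonneg_left h1 (by positivity)
      _ ≤ 1 := by rw [mul_one_div, div_le_one (by positivity)]; linarith
  have hgD : D * g₀ ≤ 1 / 4 := by
    have h1 : g₀ ≤ 1 / (4 * D + 1) :=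
      hg₀δ.le.trans ((min_le_right _ _).trans ((min_le_right _ _).trans (min_le_right _ _)))
    have hD0 : 0 ≤ D := by positivity
    calc D * g₀ ≤ D * (1 / (4 * D + 1)) := mul_le_mul_of_nonneg_left h1 hD0
      _ ≤ 1 / 4 := by rw [mul_one_div, div_le_iff₀ (by positivity)]; nlinarith
  -- the two flows
  have h0 : GbarHyp (betaPT 4 L 0) B g₀ := gbarHyp_betaPT hB hL le_rfl hg₀ hgB
  have hsH : GbarHyp (betaPT 4 L s) B g₀ := gbarHyp_betaPT hB hL hs hg₀ hgB
  rcases hs.lt_or_eq with hs' | hs'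
  swap
  · -- `m² = 0`: `g̃_j = ḡ_j(0)`
    subst hs'
    rw [gtilde_zero, sub_self, abs_zero]
    positivity
  -- `m² > 0`
  set jm := massScale L s with hjm
  have hspec := massScale_spec hL1 hs'
  -- the perturbation below `j_m` is `ℓ¹`-small: `Σ_{l<j_m}|β_l(0) - β_l(m²)| ≤ E`
  have hsum : ∑ l ∈ Finset.range jm, |betaPT 4 L 0 l - betaPT 4 L s l| ≤ E := by
    calc ∑ l ∈ Finset.range jm, |betaPT 4 L 0 l - betaPT 4 L s l|
        ≤ ∑ l ∈ Finset.range jm, K * (1 / L ^ l + s * L ^ (2 * l)) :=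
          Finset.sum_le_sum fun l _ => by rw [abs_sub_comm]; exact hM s hs hs1 l
      _ = K * ∑ l ∈ Finset.range jm, (1 / L ^ l + s * L ^ (2 * l)) := by rw [Finset.mul_sum]
      _ ≤ K * (2 + 2 * L ^ 2) := mul_le_mul_of_nonneg_left (sum_massInsensitivity_le hL hs' le_rfl) hK.le
  -- the case `j ≤ j_m`
  have hbelow : ∀ i ≤ jm, |gbar (betaPT 4 L 0) g₀ i - gbar (betaPT 4 L s) g₀ i| ≤
      6 * E * gbar (betaPT 4 L s) g₀ i ^ 2 := fun i hi =>
    h0.abs_gbar_sub_gbar_beta_le_sq hsH hE0.le hsum hgE hi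
  rw [gtilde_of_pos hs']
  rcases le_or_gt j jm with hj | hj
  · rw [min_eq_left hj]
    refine (hbelow j hj).trans ?_
    have := sq_nonneg (gbar (betaPT 4 L s) g₀ j)
    have hD0 : 0 ≤ D := by positivity
    nlinarith
  · -- the case `j > j_m`: `g̃_j = ḡ_{j_m}(0)`, `ḡ_j(m²) = ḡ_{j_m}(m²) - Σβ_lḡ_l²`
    rw [min_eq_right hj.le]
    set b := gbar (betaPT 4 L s) g₀ with hb
    have hbpos := hsH.gbar_pos
    have hanti := hsH.gbar_antitone
    -- `Σ_{l≥j_m}β_l(m²) ≤ D`: decay beyond the mass scale, `1 < m²L^{2(j_m+1)}`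
    have hlow : 1 < s * L ^ (2 * (jm + 1)) := by
      have hL2 : (1 : ℝ) < L ^ 2 := by nlinarith
      calc (1 : ℝ) ≤ s * L ^ (2 * jm) := hspec.1
        _ < s * L ^ (2 * jm) * L ^ 2 := lt_mul_of_one_lt_right (by linarith [hspec.1]) hL2
        _ = s * L ^ (2 * (jm + 1)) := by ring
    have htail : ∑ l ∈ Finset.range (j - jm), betaPT 4 L s (jm + l) ≤ D := by
      calc ∑ l ∈ Finset.range (j - jm), betaPT 4 L s (jm + l)
          ≤ ∑ l ∈ Finset.range (j - jm), Cd * ((2 : ℝ) ^ l)⁻¹ :=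
            Finset.sum_le_sum fun l _ => by
              have := hdec s hs' hs1 jm hlow (jm + l)
              rw [show jm + l - jm = l by omega] at this
              exact (le_abs_self _).trans this
        _ = Cd * ∑ l ∈ Finset.range (j - jm), ((1 : ℝ) / 2) ^ l := by
            rw [Finset.mul_sum]; refine Finset.sum_congr rfl fun l _ => by rw [one_div, inv_pow]
        _ ≤ Cd * ∑' l, ((1 : ℝ) / 2) ^ l := mul_le_mul_of_nonneg_left
            ((summable_geometric_of_lt_one (by norm_num) (by norm_num)).sum_le_tsum _
              fun l _ => by positivity) hCd.le
        _ = Cd * 2 := by rw [tsum_geometric_of_lt_one (by norm_num) (by norm_num)]; norm_num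
        _ = D := by rw [hD]; ring
    -- `0 ≤ ḡ_{j_m}(m²) - ḡ_j(m²) ≤ ḡ_{j_m}(m²)²·D`
    have hdiff : b jm - b j = ∑ l ∈ Finset.range (j - jm), betaPT 4 L s (jm + l) * b (jm + l) ^ 2 := by
      have := gbar_sub_gbar_add_eq_sum (betaPT 4 L s) g₀ jm (j - jm)
      rwa [show jm + (j - jm) = j by omega] at this
    have hdiff_le : b jm - b j ≤ D * b jm ^ 2 := by
      rw [hdiff]
      calc ∑ l ∈ Finset.range (j - jm), betaPT 4 L s (jm + l) * b (jm + l) ^ 2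
          ≤ ∑ l ∈ Finset.range (j - jm), betaPT 4 L s (jm + l) * b jm ^ 2 :=
            Finset.sum_le_sum fun l _ => mul_le_mul_of_nonneg_left
              (pow_le_pow_left₀ (hbpos _).le (hanti (Nat.le_add_right jm l)) 2)
              (hsH.beta_nonneg _)
        _ = (∑ l ∈ Finset.range (j - jm), betaPT 4 L s (jm + l)) * b jm ^ 2 := by rw [Finset.sum_mul]
        _ ≤ D * b jm ^ 2 := mul_le_mul_of_nonneg_right htail (sq_nonneg _)
    have hdiff_ge : 0 ≤ b jm - b j := sub_nonneg.2 (hanti hj.le)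
    -- hence `ḡ_{j_m}(m²) ≤ 2ḡ_j(m²)`
    have hbjm_le : b jm ≤ 2 * b j := by
      have hbg := hsH.gbar_le_init jm
      have : D * b jm ^ 2 ≤ 1 / 4 * b jm := by
        calc D * b jm ^ 2 = (D * b jm) * b jm := by ring
          _ ≤ (D * g₀) * b jm := by gcongr; exact (hbpos jm).le
          _ ≤ 1 / 4 * b jm := mul_le_mul_of_nonneg_right hgD (hbpos jm).le
      linarith
    -- assemble
    calc |gbar (betaPT 4 L 0) g₀ jm - b j|
        ≤ |gbar (betaPT 4 L 0) g₀ jm - b jm| + |b jm - b j| := abs_sub_le _ _ _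
      _ ≤ 6 * E * b jm ^ 2 + D * b jm ^ 2 := add_le_add (hbelow jm le_rfl) (by rwa [abs_of_nonneg hdiff_ge])
      _ = (6 * E + D) * b jm ^ 2 := by ring
      _ ≤ (6 * E + D) * (2 * b j) ^ 2 := by gcongr; exact (hbpos jm).le
      _ = 4 * (6 * E + D) * b j ^ 2 := by ring

/-! ### Lemma 7.3.1(iii) -/

/-- **BBS 2015, Lemma 7.3.1(iii), for the explicit decomposition**: `g̃_j(m²,g₀)` is non-decreasing
in `g₀` (for `0 < g₀ ≤ g₀'` small) and in `m² ≥ 0` ("The sequence `ḡ` is monotone increasing in `g₀`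
… Also, the sequence `ḡ` is decreasing in `j` since `β_k ≥ 0`, while `j_m` is decreasing in `m²`, so
`g̃` is increasing in `m²`"). [cite: BauerschmidtBrydgesSlade2015LogCorr, §7.3.1, Lemma 7.3.1(iii)] -/
theorem BBS2015_lem731_iii {L : ℝ} (hL : 2 ≤ L) : ∃ δ : ℝ, 0 < δ ∧
    (∀ s : ℝ, 0 ≤ s → ∀ g₀ g₀' : ℝ, 0 < g₀ → g₀ ≤ g₀' → g₀' < δ → ∀ j : ℕ,
      gtilde L s g₀ j ≤ gtilde L s g₀' j) ∧
    (∀ s s' : ℝ, 0 ≤ s → s ≤ s' → ∀ g₀ : ℝ, 0 < g₀ → g₀ < δ → ∀ j : ℕ,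
      gtilde L s g₀ j ≤ gtilde L s' g₀ j) := by
  have hL1 : (1 : ℝ) < L := by linarith
  obtain ⟨KB, hKB, hB⟩ := BBS2015_A1_bounded
  set B : ℝ := KB * L ^ 4 with hBdef
  have hB0 : 0 < B := by positivity
  refine ⟨1 / (4 * B + 1), by positivity, fun s hs g₀ g₀' hg₀ hle hlt j => ?_,
    fun s s' hs hss' g₀ hg₀ hlt j => ?_⟩
  · -- monotone in `g₀`: `ḡ_i(0,·)` is non-decreasing for every `i`
    have hsm : ∀ g : ℝ, 0 < g → g < 1 / (4 * B + 1) → B * g ≤ 1 / 4 := fun g hg hglt => by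
      calc B * g ≤ B * (1 / (4 * B + 1)) := mul_le_mul_of_nonneg_left hglt.le hB0.le
        _ ≤ 1 / 4 := by rw [mul_one_div, div_le_iff₀ (by positivity)]; nlinarith
    have h1 : GbarHyp (betaPT 4 L 0) B g₀ := gbarHyp_betaPT hB hL le_rfl hg₀ (hsm g₀ hg₀ (hle.trans_lt hlt))
    have h2 : GbarHyp (betaPT 4 L 0) B g₀' := gbarHyp_betaPT hB hL le_rfl (hg₀.trans_le hle) (hsm g₀' (hg₀.trans_le hle) hlt)
    unfold gtilde
    exact gbar_le_gbar_init h1 h2 hle _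
  · -- monotone in `m²`: `min(j, j_m)` is non-increasing in `m²` and `ḡ_i(0)` non-increasing in `i`
    have hsm : B * g₀ ≤ 1 / 4 := by
      calc B * g₀ ≤ B * (1 / (4 * B + 1)) := mul_le_mul_of_nonneg_left hlt.le hB0.le
        _ ≤ 1 / 4 := by rw [mul_one_div, div_le_iff₀ (by positivity)]; nlinarith
    have h0 : GbarHyp (betaPT 4 L 0) B g₀ := gbarHyp_betaPT hB hL le_rfl hg₀ hsm
    have hanti := h0.gbar_antitone
    unfold gtilde
    refine hanti ?_
    rcases hs.lt_or_eq with hs0 | hs0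
    · have hs'0 : 0 < s' := hs0.trans_le hss'
      rw [if_pos hs0, if_pos hs'0]
      exact min_le_min_left j (massScale_anti hL1 hs0 hss')
    · subst hs0
      rw [if_neg (lt_irrefl 0)]
      split_ifs
      · exact min_le_left _ _
      · exact le_rfl

/-! ### Lemma 7.3.1(ii) -/

/-- **`|j_m - j_{m̂}| ≤ 1`** when `|m² - m̂²| ≤ θm̂²` with `θ ≤ 1 - L⁻²` (both masses positive, `L > 1`):
`L^{2(j_{m̂}+1)}m² ≥ (1-θ)L²·L^{2j_{m̂}}m̂² ≥ 1` and `L^{2(j_m+1)}m̂² ≥ L²L^{2j_m}m²/(1+θ) ≥ 1`.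
[cite: BauerschmidtBrydgesSlade2015LogCorr, §7.3.1, Lemma 7.3.1(ii) (proof: "|j_{m̂} - j_m| ≤ 1 + |log_{L²}m̂² - log_{L²}m²| … < 2. Thus, since j_m is an integer, |j_{m̂} - j_m| ≤ 1")] -/
theorem massScale_sub_le_one {L : ℝ} (hL : 1 < L) {θ : ℝ} (hθ0 : 0 ≤ θ) (hθ : θ ≤ 1 - (L ^ 2)⁻¹)
    {s s' : ℝ} (hs : 0 < s) (hs' : 0 < s') (hclose : |s - s'| ≤ θ * s') :
    massScale L s ≤ massScale L s' + 1 ∧ massScale L s' ≤ massScale L s + 1 := by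
  have hL2 : 1 < L ^ 2 := by nlinarith
  have hL20 : 0 < L ^ 2 := by positivity
  have hθ1 : θ < 1 := by
    have : 0 < (L ^ 2)⁻¹ := by positivity
    linarith
  have hlow : (1 - θ) * s' ≤ s := by linarith [(abs_le.1 hclose).1]
  have hup : s ≤ (1 + θ) * s' := by linarith [(abs_le.1 hclose).2]
  have hkey : 1 ≤ (1 - θ) * L ^ 2 := by
    have : (L ^ 2)⁻¹ * L ^ 2 = 1 := inv_mul_cancel₀ hL20.ne'
    nlinarith
  obtain ⟨h1, -⟩ := massScale_spec hL hs
  obtain ⟨h1', -⟩ := massScale_spec hL hs'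
  constructor
  · refine massScale_le_of_one_le ?_
    calc (1 : ℝ) ≤ ((1 - θ) * L ^ 2) * (s' * L ^ (2 * massScale L s')) :=
          one_le_mul_of_one_le_of_one_le hkey h1'
      _ = ((1 - θ) * s') * L ^ (2 * (massScale L s' + 1)) := by ring
      _ ≤ s * L ^ (2 * (massScale L s' + 1)) := mul_le_mul_of_nonneg_right hlow (by positivity)
  · refine massScale_le_of_one_le ?_
    have h2 : 1 + θ ≤ L ^ 2 := by
      have : θ ≤ 1 := hθ1.le
      nlinarith
    calc (1 : ℝ) ≤ s * L ^ (2 * massScale L s) := h1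
      _ ≤ (1 + θ) * s' * L ^ (2 * massScale L s) := mul_le_mul_of_nonneg_right hup (by positivity)
      _ ≤ L ^ 2 * s' * L ^ (2 * massScale L s) := by gcongr
      _ = s' * L ^ (2 * (massScale L s + 1)) := by ring

/-- Indices differing by at most one cost `O(ḡ²)`: `|ḡ_i - ḡ_{i'}| ≤ 2Bḡ_{i'}²` for `|i - i'| ≤ 1`
(`β ≥ 0`: one step of the recursion is `β_iḡ_i² ≤ Bḡ_i²`, and `ḡ_i ≤ (4/3)ḡ_{i+1}`).
[cite: BauerschmidtBrydgesSlade2015LogCorr, §7.3.1, Lemma 7.3.1(ii) (proof: "By (gbar), |ḡ_{j_m^*} - ḡ_{j_{m̂}^*}| ≤ O(ḡ²_{j_{m̂}^*})")] -/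
theorem abs_gbar_sub_gbar_of_dist_le_one {β : ℕ → ℝ} {B g₀ : ℝ} (h : GbarHyp β B g₀) {i i' : ℕ}
    (h1 : i ≤ i' + 1) (h2 : i' ≤ i + 1) : |gbar β g₀ i - gbar β g₀ i'| ≤ 2 * B * gbar β g₀ i' ^ 2 := by
  have hB := h.B_nonneg
  have hstep : ∀ n, gbar β g₀ n - gbar β g₀ (n + 1) ≤ B * gbar β g₀ n ^ 2 := fun n => by
    rw [gbar_succ]
    have := h.beta_le n
    nlinarith [sq_nonneg (gbar β g₀ n)]
  have hmono := h.gbar_antitone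
  have h43 : ∀ n, gbar β g₀ n ≤ 4 / 3 * gbar β g₀ (n + 1) := fun n => by
    rw [gbar_succ' β g₀ n]
    have := h.one_sub_ge n
    have := (h.gbar_pos n).le
    nlinarith
  rcases Nat.lt_trichotomy i i' with hlt | heq | hgt
  · -- `i' = i + 1`
    have hi' : i' = i + 1 := by omega
    subst hi'
    rw [abs_of_nonneg (sub_nonneg.2 (hmono (Nat.le_succ i)))]
    calc gbar β g₀ i - gbar β g₀ (i + 1) ≤ B * gbar β g₀ i ^ 2 := hstep i
      _ ≤ B * (4 / 3 * gbar β g₀ (i + 1)) ^ 2 := by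
          gcongr
          exact (h.gbar_pos i).le
          exact h43 i
      _ = 16 / 9 * B * gbar β g₀ (i + 1) ^ 2 := by ring
      _ ≤ 2 * B * gbar β g₀ (i + 1) ^ 2 := by nlinarith [mul_nonneg hB (sq_nonneg (gbar β g₀ (i + 1)))]
  · subst heq; simp; positivity
  · -- `i = i' + 1`
    have hi : i = i' + 1 := by omega
    subst hi
    rw [abs_sub_comm, abs_of_nonneg (sub_nonneg.2 (hmono (Nat.le_succ i')))]
    calc gbar β g₀ i' - gbar β g₀ (i' + 1) ≤ B * gbar β g₀ i' ^ 2 := hstep i'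
      _ ≤ 2 * B * gbar β g₀ i' ^ 2 := by nlinarith [mul_nonneg hB (sq_nonneg (gbar β g₀ i'))]

/-- **BBS 2015, Lemma 7.3.1(ii), for the explicit decomposition**: there are `δ > 0` and `C` such that
for `θ ∈ [0,½]`, `(m²,g₀), (m̂²,ĝ₀) ∈ [0,δ) × (0,δ)` with `|m² - m̂²| ≤ θm̂²` and `|g₀ - ĝ₀| ≤ θĝ₀`,
and every `j`: `|g̃_j(m²,g₀) - g̃_j(m̂²,ĝ₀)| ≤ (θ + Cg₀)·g̃_j(m̂²,ĝ₀)`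
("`|g̃_j(m²,g₀) - g̃_j(m̂²,ĝ₀)| ≤ (θ + O(g₀))g̃_j(m̂²,ĝ₀)` … for sufficiently small `θ > 0`").
[cite: BauerschmidtBrydgesSlade2015LogCorr, §7.3.1, Lemma 7.3.1(ii)] -/
theorem BBS2015_lem731_ii {L : ℝ} (hL : 2 ≤ L) : ∃ δ C : ℝ, 0 < δ ∧ 0 < C ∧
    ∀ θ : ℝ, 0 ≤ θ → θ ≤ 1 / 2 → ∀ s s' : ℝ, 0 ≤ s → s < δ → 0 ≤ s' → s' < δ →
      ∀ g₀ g₀' : ℝ, 0 < g₀ → g₀ < δ → 0 < g₀' → g₀' < δ →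
        |s - s'| ≤ θ * s' → |g₀ - g₀'| ≤ θ * g₀' → ∀ j : ℕ,
          |gtilde L s g₀ j - gtilde L s' g₀' j| ≤ (θ + C * g₀) * gtilde L s' g₀' j := by
  have hL1 : (1 : ℝ) < L := by linarith
  obtain ⟨KB, hKB, hB⟩ := BBS2015_A1_bounded
  set B : ℝ := KB * L ^ 4 with hBdef
  have hB0 : 0 < B := by positivity
  refine ⟨1 / (4 * B + 1), 16 * B, by positivity, by positivity, fun θ hθ0 hθ s s' hs hsδ hs' hs'δ g₀ g₀'
    hg₀ hg₀δ hg₀' hg₀'δ hss' hgg' j => ?_⟩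
  have hsm : ∀ g : ℝ, 0 < g → g < 1 / (4 * B + 1) → B * g ≤ 1 / 4 := fun g hg hglt => by
    calc B * g ≤ B * (1 / (4 * B + 1)) := mul_le_mul_of_nonneg_left hglt.le hB0.le
      _ ≤ 1 / 4 := by rw [mul_one_div, div_le_iff₀ (by positivity)]; nlinarith
  have h0 : GbarHyp (betaPT 4 L 0) B g₀ := gbarHyp_betaPT hB hL le_rfl hg₀ (hsm g₀ hg₀ hg₀δ)
  have h0' : GbarHyp (betaPT 4 L 0) B g₀' := gbarHyp_betaPT hB hL le_rfl hg₀' (hsm g₀' hg₀' hg₀'δ)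
  -- the two indices `i = min(j, j_m)`, `i' = min(j, j_{m̂})` (with `j` itself at zero mass) differ by ≤ 1
  set i : ℕ := if 0 < s then min j (massScale L s) else j with hi
  set i' : ℕ := if 0 < s' then min j (massScale L s') else j with hi'
  have hii' : i ≤ i' + 1 ∧ i' ≤ i + 1 := by
    rcases hs'.lt_or_eq with hs'pos | hs'0
    · -- `m̂² > 0`, hence `m² > 0` (`θ < 1`)
      have hspos : 0 < s := by
        have := (abs_le.1 hss').1
        nlinarith
      have hθL : θ ≤ 1 - (L ^ 2)⁻¹ := by
        have hL4 : (4 : ℝ) ≤ L ^ 2 := by nlinarith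
        have : (L ^ 2)⁻¹ ≤ 1 / 4 := by rw [inv_le_comm₀ (by positivity) (by norm_num)]; linarith
        linarith
      obtain ⟨h1, h2⟩ := massScale_sub_le_one hL1 hθ0 hθL hspos hs'pos hss'
      rw [hi, hi', if_pos hspos, if_pos hs'pos]
      constructor <;> omega
    · -- `m̂² = 0` forces `m² = 0`
      subst hs'0
      have hs0 : s = 0 := by
        have := (abs_le.1 hss')
        simp at this
        linarith [abs_nonneg s]
      subst hs0
      rw [hi, hi', if_neg (lt_irrefl 0)]
      omega
  -- `g̃_j(m²,g₀) = ḡ_i(0,g₀)`, `g̃_j(m̂²,ĝ₀) = ḡ_{i'}(0,ĝ₀)`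
  have e1 : gtilde L s g₀ j = gbar (betaPT 4 L 0) g₀ i := rfl
  have e2 : gtilde L s' g₀' j = gbar (betaPT 4 L 0) g₀' i' := rfl
  rw [e1, e2]
  -- `|ḡ_{i'}(g₀) - ḡ_{i'}(ĝ₀)| ≤ θḡ_{i'}(ĝ₀)` (Lemma 2.1(iv)) and `ḡ_{i'}(g₀) ≤ (1+θ)ḡ_{i'}(ĝ₀)`
  have hcmp : |gbar (betaPT 4 L 0) g₀' i' - gbar (betaPT 4 L 0) g₀ i'| ≤ θ * gbar (betaPT 4 L 0) g₀' i' :=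
    GbarHyp.abs_gbar_sub_gbar_le h0 h0' (by rwa [abs_sub_comm] at hgg') i'
  have hgi' : gbar (betaPT 4 L 0) g₀ i' ≤ (1 + θ) * gbar (betaPT 4 L 0) g₀' i' := by
    linarith [(abs_le.1 hcmp).1]
  -- the index step: `|ḡ_i(g₀) - ḡ_{i'}(g₀)| ≤ 2Bḡ_{i'}(g₀)² ≤ 2B(1+θ)²ḡ_{i'}(ĝ₀)² ≤ 8Bĝ₀·ḡ_{i'}(ĝ₀)`
  have hidx := abs_gbar_sub_gbar_of_dist_le_one h0 hii'.1 hii'.2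
  have hb' := (h0'.gbar_pos i').le
  have hb'g := h0'.gbar_le_init i'
  have hg₀'le : g₀' ≤ 2 * g₀ := by
    have := (abs_le.1 hgg').1
    nlinarith
  calc |gbar (betaPT 4 L 0) g₀ i - gbar (betaPT 4 L 0) g₀' i'|
      ≤ |gbar (betaPT 4 L 0) g₀ i - gbar (betaPT 4 L 0) g₀ i'| +
          |gbar (betaPT 4 L 0) g₀ i' - gbar (betaPT 4 L 0) g₀' i'| := abs_sub_le _ _ _
    _ ≤ 2 * B * gbar (betaPT 4 L 0) g₀ i' ^ 2 + θ * gbar (betaPT 4 L 0) g₀' i' :=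
        add_le_add hidx (by rwa [abs_sub_comm] at hcmp)
    _ ≤ 2 * B * ((1 + θ) * gbar (betaPT 4 L 0) g₀' i') ^ 2 + θ * gbar (betaPT 4 L 0) g₀' i' := by
        gcongr
        exact (h0.gbar_pos i').le
    _ = (θ + 2 * B * (1 + θ) ^ 2 * gbar (betaPT 4 L 0) g₀' i') * gbar (betaPT 4 L 0) g₀' i' := by ring
    _ ≤ (θ + 16 * B * g₀) * gbar (betaPT 4 L 0) g₀' i' := by
        refine mul_le_mul_of_nonneg_right ?_ hb'
        have h1 : (1 + θ) ^ 2 ≤ 4 := by nlinarith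
        have h2 : 2 * B * (1 + θ) ^ 2 * gbar (betaPT 4 L 0) g₀' i' ≤ 2 * B * 4 * g₀' := by
          have := mul_le_mul h1 hb'g hb' (by norm_num : (0 : ℝ) ≤ 4)
          nlinarith [hB0.le]
        nlinarith [hB0.le]

end CTWSAW

end Literature.Barriers.CriticalPhenomena
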